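import Summits.ResolutionOfSingularities.ResolutionOfSingularities.Theorems.UniformComplexityCampaignW82SeparableTightnessCore
import Summits.ResolutionOfSingularities.ResolutionOfSingularities.Theorems.UniformComplexityCampaignW82SeparableTightnessPencil
import HarnessLib

/-!
# [OURS · L1 W8.2] Separable tightness of resolution in families — the two-fibre obstruction (family level)

Cell `res-hironaka` (run/shared/lean/pub/res-hironaka/), LADDER-RESOLUTION rung L (RESCUE), slot W8.2, door 2
(`UniformComplexity`, host item `PrimeModelTransfer` stmt-ResolutionOfSingularities-8933); prover res-L1-s82-pv-2
(gen 7). THESES-FREE module (imports the gen-7 siblings `…SeparableTightnessCore` (p555296: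
`false_of_isRegular_pullback_proper_isoOver`) and `…SeparableTightnessPencil` (p556612: the Kollár pencil over a
ring, `pullbackPencilIso`, `isIntegral_of_flat_of_isPullback`), `HarnessLib`).

THE POINT. `CampaignW82.FamilyResolution` / `CampaignW82.FamilyResolutionSep` (p526769 / p554368) ask, after a
base extension `A → A'`, for ONE `G : 𝒴 → 𝒳 ×_A Spec A'` whose fibre over EVERY field-valued point of `Spec A'`
is a weak resolution. This file reads that demand at TWO points — `φ : A' → K'` and `ι ∘ φ : A' → Ω` with `Ω`
perfect (the generic point `A' → Frac A'` and the geometric generic point `A' → (Frac A')^{alg}` in the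
headline file) — for a family `𝒳 → Spec A` containing the Kollár pencil `y^q = x^p − t` as a dense open:

* `false_of_isWeakResolution_two_fibres'` — base extension an ARBITRARY morphism `S' → Spec A`, points
  `s₁ : Spec K' → S'` over a FLAT `φ₀ : A → K'` with `X^p − φ₀(t)` irreducible and `s₂ = Spec ι ≫ s₁`:
  the fibres of `G` over `s₁` and `s₂` are not both weak resolutions.
* **`false_of_isWeakResolution_two_fibres`** — the same with the fibres formed LITERALLY as in
  `CampaignW82.FamilyResolution(Sep)` (`S' = Spec A'`, `s₁ = Spec φ`, `s₂ = Spec (ι ∘ φ)`): the shape consumed by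
  `CampaignW82.not_familyResolutionSep_of_witness` in the headline file `…SeparableTightness`.

Mechanism: the fibre `X₁ = 𝒳_{A'} ×_{A'} Spec K'` is the flat base change of `𝒳` along `Spec φ₀`, hence
integral (it contains the integral curve `C_1(K', φ₀ t)` as the base change of the dense pencil) and contains
that curve as an open subscheme over `K'`; the fibre of `G` over `s₁` is proper and an isomorphism over a
non-empty open of `X₁`; its base change along `Spec Ω → Spec K'` is (pasting of pullbacks) the fibre over `s₂`,
which is REGULAR — so by fpqc descent the fibre over `s₁` has a source SMOOTH over `K'`, and restricted over the
Kollár curve it is a smooth proper birational model of `y^q = x^p − φ₀(t)` with `φ₀(t) ∉ K'^p`: impossible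
(`TwistExponent.no_smooth_model_twistCurve`, p509195, through `false_of_isRegular_pullback_proper_isoOver`).

HONEST FRAMING. OURS negative-side bookkeeping for the campaign statement `CampaignW82.FamilyResolutionSep`
(p554368); NOT a statement of H. Hironaka's 2017 manuscript ([Hironaka2017]); nothing here is attributed to its
author. AI work, weaker than expert review.

## References (vocabulary and locators only)
* J. Kollár, *Lectures on Resolution of Singularities* (2007), 1.19. [Kollar2007]
* The Stacks Project, Tags 02VL (fpqc descent of smoothness), 0CMK (flat base change of scheme-theoretically
  dense opens). [StacksProject]
-/

noncomputable section

set_option linter.dupNamespace false -- mandated namespace of this single-conjunct summit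

open Polynomial
open _root_.CategoryTheory _root_.CategoryTheory.Limits _root_.AlgebraicGeometry _root_.TopologicalSpace
open Literature.AlgebraicGeometry.Resolution

namespace Summit.ResolutionOfSingularities.ResolutionOfSingularities.Theorems.CampaignW82.SeparableTightness

/-! ## The two-fibre obstruction -/

section TwoFibres

variable {A : Type} [CommRing A] (p : ℕ) (t : A) (q : ℕ)

/-- **THE TWO-FIBRE OBSTRUCTION, over an arbitrary base change `S' → Spec A`.** Let `f : 𝒳 → Spec A` be
locally of finite type and contain the Kollár pencil `y^q = x^p − t` as a quasi-compact, scheme-theoretically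
dominant open subscheme over `A` (`j ≫ f = pencilTo`). Let `ψ' : S' → Spec A` be any morphism (the base
extension), `s₁ : Spec K' → S'` a point with values in a field `K'` of characteristic `p` lying over a ring map
`φ₀ : A → K'` (`s₁ ≫ ψ' = Spec φ₀`) which is FLAT (e.g. `A` Dedekind and `φ₀` injective) and along which `t`
acquires NO `p`-th root (`X^p − φ₀ t` irreducible over `K'`), and `s₂ = Spec ι ≫ s₁` for a ring map
`ι : K' → Ω` to a PERFECT field. Then no `G : 𝒴 → 𝒳 ×_{Spec A} S'` has both its fibre over `s₁` and its
fibre over `s₂` weak resolutions (`CampaignW82.IsWeakResolution`; fibres formed as in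
`CampaignW82.FamilyResolution`). Proof: `X₁ = (𝒳 ×_A S') ×_{S'} Spec K'` is the flat base change of `𝒳`
along `Spec φ₀`, so it is integral — it contains the integral curve `C_1(K', φ₀ t)` as the base change of the
dense pencil (`isIntegral_of_flat_of_isPullback`, `pullbackPencilIso`) — and contains that curve as an open
subscheme over `K'`; the fibre of `G` over `s₁` is proper and an isomorphism over a non-empty open of `X₁`, and
its base change along `Spec Ω → Spec K'` is the fibre of `G` over `s₂` (pasting of pullbacks), which is
regular: `false_of_isRegular_pullback_proper_isoOver` (p555296) concludes. [cite: Kollar2007, 1.19] -/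
theorem false_of_isWeakResolution_two_fibres' [Fact p.Prime] [Fact q.Prime] (hqp : q ≠ p)
    {𝒳 : Scheme.{0}} (f : 𝒳 ⟶ Spec (.of A)) [LocallyOfFiniteType f]
    (j : pencil A p t q ⟶ 𝒳) [IsOpenImmersion j] [QuasiCompact j] [IsSchemeTheoreticallyDominant j]
    (hj : j ≫ f = pencilTo A p t q)
    {S' : Scheme.{0}} (ψ' : S' ⟶ Spec (.of A))
    {K' Ω : Type} [Field K'] [CharP K' p] [Field Ω] [PerfectField Ω] (φ₀ : A →+* K') (ι : K' →+* Ω)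
    (s₁ : Spec (.of K') ⟶ S') (hcomp : s₁ ≫ ψ' = Spec.map (CommRingCat.ofHom φ₀))
    (s₂ : Spec (.of Ω) ⟶ S') (hs₂ : s₂ = Spec.map (CommRingCat.ofHom ι) ≫ s₁)
    (hflat : φ₀.Flat) (ht : Irreducible (X ^ p - C (φ₀ t) : K'[X]))
    {𝒴 : Scheme.{0}} (G : 𝒴 ⟶ pullback f ψ')
    (h₁ : IsWeakResolution (pullback.snd G (pullback.fst (pullback.snd f ψ') s₁)))
    (h₂ : IsWeakResolution (pullback.snd G (pullback.fst (pullback.snd f ψ') s₂))) : False := by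
  subst hs₂
  -- notation
  set f' := pullback.snd f ψ' with hf'
  set sΩ : Spec (.of Ω) ⟶ Spec (.of K') := Spec.map (CommRingCat.ofHom ι) with hsΩ
  set c₁ := pullback.fst f' s₁ with hc₁
  set g := pullback.snd f' s₁ with hg
  set c₂ := pullback.fst f' (sΩ ≫ s₁) with hc₂
  set g₂ := pullback.snd f' (sΩ ≫ s₁) with hg₂
  set π := pullback.snd G c₁ with hπ
  set π₂ := pullback.snd G c₂ with hπ₂
  set b₁ := c₁ ≫ pullback.fst f ψ' with hb₁
  obtain ⟨hproper, -, W, hW, hiso⟩ := h₁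
  have hreg₂ : Scheme.IsRegular (pullback G c₂) := h₂.isRegular
  -- the composite square `X₁ → 𝒳` over `Spec K' → Spec A`; flatness of `b₁ : X₁ → 𝒳`
  have sq₀ : IsPullback (pullback.fst f ψ') f' f ψ' := IsPullback.of_hasPullback f ψ'
  have sq₁ : IsPullback c₁ g f' s₁ := IsPullback.of_hasPullback f' s₁
  have sqb : IsPullback b₁ g f (Spec.map (CommRingCat.ofHom φ₀)) := hcomp ▸ sq₁.paste_horiz sq₀
  haveI : Flat (Spec.map (CommRingCat.ofHom φ₀)) := (HasRingHomProperty.Spec_iff (P := @Flat)).mpr hflat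
  haveI : Flat b₁ := MorphismProperty.of_isPullback (P := @Flat) sqb.flip inferInstance
  -- `P = pencil ×_𝒳 X₁ ≅ C_1(K', φ₀ t)` is integral, hence `X₁` is integral
  have sqP : IsPullback (pullback.fst j b₁) (pullback.snd j b₁) j b₁ := IsPullback.of_hasPullback j b₁
  have sqP' : IsPullback (pullback.fst j b₁) (pullback.snd j b₁ ≫ g) (pencilTo A p t q)
      (Spec.map (CommRingCat.ofHom φ₀)) := by
    rw [← hj]; exact sqP.paste_vert sqb
  let eP : pullback j b₁ ≅ TwistExponent.twistCurve K' p (φ₀ t) q 1 :=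
    sqP'.isoPullback ≪≫ pullbackPencilIso A p t q φ₀
  haveI : IsIntegral (pullback (pencilTo A p t q) (Spec.map (CommRingCat.ofHom φ₀))) :=
    isIntegral_pullback_pencil A p t q hqp φ₀
  haveI : Nonempty ↥(pullback j b₁) := ⟨sqP'.isoPullback.inv (Classical.arbitrary _)⟩
  haveI : IsIntegral (pullback j b₁) := isIntegral_of_isOpenImmersion sqP'.isoPullback.hom
  haveI : IsIntegral (pullback f' s₁) := isIntegral_of_flat_of_isPullback j b₁ sqP
  -- Kollár's curve inside `X₁`, over `K'`
  let i : TwistExponent.twistCurve K' p (φ₀ t) q 1 ⟶ pullback f' s₁ := eP.inv ≫ pullback.snd j b₁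
  haveI : IsOpenImmersion i := inferInstance
  have hi : i ≫ g = TwistExponent.twistCurveTo K' p (φ₀ t) q 1 := by
    change ((pullbackPencilIso A p t q φ₀).inv ≫ sqP'.isoPullback.inv) ≫ pullback.snd j b₁ ≫ g = _
    rw [Category.assoc, Iso.inv_comp_eq, sqP'.isoPullback_inv_snd, pullbackPencilIso_hom_comp]
  -- the fibre over `s₂ = Spec ι ≫ s₁` is the base change of the fibre over `s₁` along `Spec Ω → Spec K'`
  have sq₂ : IsPullback c₂ g₂ f' (sΩ ≫ s₁) := IsPullback.of_hasPullback f' (sΩ ≫ s₁)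
  let x : pullback f' (sΩ ≫ s₁) ⟶ pullback f' s₁ :=
    pullback.lift c₂ (g₂ ≫ sΩ) (by rw [Category.assoc]; exact sq₂.w)
  have hx₁ : x ≫ c₁ = c₂ := pullback.lift_fst _ _ _
  have hx₂ : x ≫ g = g₂ ≫ sΩ := pullback.lift_snd _ _ _
  have sqx : IsPullback x g₂ g sΩ := IsPullback.of_right (by rw [hx₁]; exact sq₂) hx₂ sq₁
  have sqY₁ : IsPullback (pullback.fst G c₁) π G c₁ := IsPullback.of_hasPullback G c₁
  have sqY₂ : IsPullback (pullback.fst G c₂) π₂ G c₂ := IsPullback.of_hasPullback G c₂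
  let y : pullback G c₂ ⟶ pullback G c₁ :=
    pullback.lift (pullback.fst G c₂) (π₂ ≫ x) (by rw [Category.assoc, hx₁]; exact sqY₂.w)
  have hy₁ : y ≫ pullback.fst G c₁ = pullback.fst G c₂ := pullback.lift_fst _ _ _
  have hy₂ : y ≫ π = π₂ ≫ x := pullback.lift_snd _ _ _
  have sqy : IsPullback y π₂ π x := IsPullback.of_right (by rw [hy₁, hx₁]; exact sqY₂) hy₂ sqY₁
  have sqyΩ : IsPullback y (π₂ ≫ g₂) (π ≫ g) sΩ := sqy.paste_vert sqx
  have hregΩ : Scheme.IsRegular (pullback (π ≫ g) sΩ) :=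
    Literature.AlgebraicGeometry.Resolution.Scheme.IsRegular.of_iso sqyΩ.isoPullback.hom hreg₂
  -- conclude
  haveI := hproper
  haveI : LocallyOfFiniteType (π ≫ g) := inferInstance
  exact false_of_isRegular_pullback_proper_isoOver K' p (φ₀ t) q hqp ht ι g i hi π W hW hiso hregΩ

/-- **THE TWO-FIBRE OBSTRUCTION (separable tightness of resolution in families, family level)** — the
instance of `false_of_isWeakResolution_two_fibres'` with the fibres formed LITERALLY as in
`CampaignW82.FamilyResolution` / `CampaignW82.FamilyResolutionSep`: base extension `Spec A' → Spec A` of an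
`A`-algebra `A'`, the point `φ : A' → K'` (think: `K' = Frac A'`, the generic point) and the point
`ι ∘ φ : A' → Ω` (think: `Ω = (Frac A')^{alg}`, the geometric generic point). Hypotheses: `A → K'` flat and
`X^p − φ(t)` irreducible over `K'` — for `A = k[t]` and the generic point of a domain `A'` injective over `A`,
the former is automatic and the latter says that `t` is not a `p`-th power in `Frac A'`, which holds whenever
`Frac A' / k(t)` is separable. Conclusion: the fibres of `G` over `φ` and over `ι ∘ φ` are not both weak
resolutions. [cite: Kollar2007, 1.19] -/
theorem false_of_isWeakResolution_two_fibres [Fact p.Prime] [Fact q.Prime] (hqp : q ≠ p)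
    {𝒳 : Scheme.{0}} (f : 𝒳 ⟶ Spec (.of A)) [LocallyOfFiniteType f]
    (j : pencil A p t q ⟶ 𝒳) [IsOpenImmersion j] [QuasiCompact j] [IsSchemeTheoreticallyDominant j]
    (hj : j ≫ f = pencilTo A p t q)
    {A' : Type} [CommRing A'] [Algebra A A']
    {K' Ω : Type} [Field K'] [CharP K' p] [Field Ω] [PerfectField Ω] (φ : A' →+* K') (ι : K' →+* Ω)
    (hflat : (φ.comp (algebraMap A A')).Flat)
    (ht : Irreducible (X ^ p - C (φ (algebraMap A A' t)) : K'[X]))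
    {𝒴 : Scheme.{0}} (G : 𝒴 ⟶ pullback f (Spec.map (CommRingCat.ofHom (algebraMap A A'))))
    (h₁ : IsWeakResolution
      (pullback.snd G
        (pullback.fst (pullback.snd f (Spec.map (CommRingCat.ofHom (algebraMap A A'))))
          (Spec.map (CommRingCat.ofHom φ)))))
    (h₂ : IsWeakResolution
      (pullback.snd G
        (pullback.fst (pullback.snd f (Spec.map (CommRingCat.ofHom (algebraMap A A'))))
          (Spec.map (CommRingCat.ofHom (ι.comp φ)))))) : False :=
  false_of_isWeakResolution_two_fibres' p t q hqp f j hj (Spec.map (CommRingCat.ofHom (algebraMap A A')))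
    (φ.comp (algebraMap A A')) ι (Spec.map (CommRingCat.ofHom φ))
    (by rw [← Spec.map_comp, ← CommRingCat.ofHom_comp])
    (Spec.map (CommRingCat.ofHom (ι.comp φ))) (by rw [← Spec.map_comp, ← CommRingCat.ofHom_comp])
    hflat ht G h₁ h₂

end TwoFibres

end Summit.ResolutionOfSingularities.ResolutionOfSingularities.Theorems.CampaignW82.SeparableTightness

end
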